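import Literature.Computability.MetaComplexity.KEvaluations
import Literature.Computability.MetaComplexity.PHPSwitchingLemma
import Literature.Computability.Complexity.ProofComplexity
import Mathlib.Data.Nat.Choose.Bounds
import Mathlib.Data.Nat.Factorial.Basic
import Mathlib.Tactic.Ring
import Mathlib.Tactic.FieldSimp
import Mathlib.Tactic.Positivity
import Mathlib.Tactic.Linarith
import Mathlib.Tactic.GCongr
import HarnessLib

/-!
# Existence of `k`-evaluations after a restriction and the PHP lower bound (Krajíček 1995, Thm. 12.4.3, Thm. 12.5.3)

Topic `Literature/Computability/MetaComplexity`. The level-by-level construction of a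
`k`-evaluation (`KEvaluations.lean`, Def. 12.4.1) of a small subformula-closed set `Γ` of
bounded-depth formulas after a suitable restriction of the pigeonhole variables
(Krajíček 1995, Thm. 12.4.3; Krajíček–Pudlák–Woods 1995; Krajíček 2019, Lemma 15.2.3), from
the PHP switching lemma (`PHPSwitchingLemma.lean`, `PBij.php_switching`) and the restriction
calculus of `k`-evaluations (`KEval.restrict`, Lemma 12.4.2), and the resulting numeric form of
the lower bound (Thm. 12.5.3) for `textbookFrege`:

* `levelSet Γ ℓ` — the formulas of `Γ` of alternation depth `≤ ℓ`.
* `KEval.base` — the canonical evaluation of atoms and constants (depth `0`).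
* `KEval.extend` — extending an evaluation of `levelSet Γ ℓ` by complete systems chosen for the
  new `∨`/`∧`-blocks of depth `ℓ + 1`, which must refine the unions prescribed by Def. 12.4.1.
* `bump`, `levelSize`, `bump_ineq` — an explicit integer parameter schedule satisfying the
  counting inequality of `PBij.php_switching`.
* `exists_kEval_levels`, `exists_restriction_kEval` — **Thm. 12.4.3**: if `|Γ| ≤ 2^{s+1}`
  and `levelSize s base d ≤ n`, there is a restriction leaving exactly `base` holes free and a
  `2s`-evaluation of `Γ` relative to it.
* `lt_proofSize_of_isDepthProofOf_pigeonholeForm` — **Thm. 12.5.3** (numeric form): if `1 ≤ s`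
  and `levelSize s (baseOf s) d ≤ n` then every depth-`d` `textbookFrege`-proof of
  `pigeonholeForm (n+1) n` has size `> 2^{s+1}`; `levelSize_poly`: the schedule is polynomial
  in `s`, which yields the `2^{n^{ε_d}}` form (`ProofComplexityProofs.lean`).

## References

* J. Krajíček, *Bounded arithmetic, propositional logic, and complexity theory*, CUP 1995,
  Thm. 12.4.3, Thm. 12.5.3 (with Lemma 12.3.10, Def. 12.4.1, Lemmas 12.4.2, 12.4.4, 12.5.2)
  [Krajicek1995].
* J. Krajíček, P. Pudlák, A. Woods, Random Structures Algorithms 7 (1995) 15–39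
  [KrajicekPudlakWoods1995].
* J. Krajíček, *Proof complexity*, CUP 2019, Lemma 15.2.3, Thm. 15.3.1 [Krajicek2019].

## Design choices

* The parameters are integers: at a level after which `m` holes stay free we restrict
  `w = bump m s` pairs, an explicit polynomial making the inequality of `PBij.php_switching`
  hold with `N ≤ 2^{s+1}` sets (`bump_ineq`); Krajíček's schedule `n ↦ n^{ε}` is replaced by
  the recursion `levelSize`. An initial restriction cuts the `n` holes of `PHP^{n+1}_n` down to
  exactly `levelSize s base d`.
* `k = 2s` throughout; the final universe keeps `baseOf s = 37 (s+1) + 3 ≥ 18 k + 3` holes, as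
  required by `KEval.not_isProofOf_pigeonhole`.
-/

namespace Literature.Computability.MetaComplexity

open Complexity Complexity.PropForm PBij

/-! ### Depth facts -/

section AltDepth

variable {ν : Type*}

/-- Negations have positive alternation depth. [folklore] -/
theorem altDepth_pos_of_neg (φ : PropForm ν) : 0 < (PropForm.neg φ).altDepth := by
  simp [PropForm.altDepth, PropForm.altDepthAux]

/-- Conjunctions have positive alternation depth. [folklore] -/
theorem altDepth_pos_of_conj (a b : PropForm ν) : 0 < (PropForm.conj a b).altDepth := by
  simp [PropForm.altDepth, PropForm.altDepthAux]

/-- Disjunctions have positive alternation depth. [folklore] -/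
theorem altDepth_pos_of_disj (a b : PropForm ν) : 0 < (PropForm.disj a b).altDepth := by
  simp [PropForm.altDepth, PropForm.altDepthAux]

end AltDepth

/-! ### Level sets -/

/-- The formulas of `Γ` of alternation depth at most `ℓ` (Krajíček's `Γ'` in the proof of
Thm. 12.4.3). [cite: Krajicek1995, Thm. 12.4.3 (proof)] -/
def levelSet (Γ : Finset (PropForm ℕ)) (ℓ : ℕ) : Finset (PropForm ℕ) :=
  Γ.filter fun φ => φ.altDepth ≤ ℓ

/-- Membership in a level set. [cite: Krajicek1995, Thm. 12.4.3 (proof)] -/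
theorem mem_levelSet {Γ : Finset (PropForm ℕ)} {ℓ : ℕ} {φ : PropForm ℕ} :
    φ ∈ levelSet Γ ℓ ↔ φ ∈ Γ ∧ φ.altDepth ≤ ℓ := by
  rw [levelSet, Finset.mem_filter]

/-- Level sets of a subformula-closed set are subformula-closed. [folklore] -/
theorem subClosed_levelSet {Γ : Finset (PropForm ℕ)} (hΓ : SubClosed Γ) (ℓ : ℕ) :
    SubClosed (levelSet Γ ℓ) := by
  intro φ hφ ψ hψ
  rw [mem_levelSet] at hφ ⊢
  exact ⟨hΓ φ hφ.1 hψ, (altDepth_le_of_mem_subforms hψ).trans hφ.2⟩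

/-- If all formulas of `Γ` have depth `≤ d`, the top level set is `Γ`. [folklore] -/
theorem levelSet_eq_self {Γ : Finset (PropForm ℕ)} {d : ℕ} (h : ∀ φ ∈ Γ, φ.altDepth ≤ d) :
    levelSet Γ d = Γ :=
  Finset.filter_true_of_mem h

/-- Variables are in every level set of a set containing them. [folklore] -/
theorem var_mem_levelSet {Γ : Finset (PropForm ℕ)} {ℓ : ℕ} {v : ℕ} (h : PropForm.var v ∈ Γ) :
    PropForm.var v ∈ levelSet Γ ℓ :=
  mem_levelSet.2 ⟨h, by simp [PropForm.altDepth, PropForm.altDepthAux]⟩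

/-- Constants are in every level set of a set containing them. [folklore] -/
theorem const_mem_levelSet {Γ : Finset (PropForm ℕ)} {ℓ : ℕ} {b : Bool} (h : PropForm.const b ∈ Γ) :
    PropForm.const b ∈ levelSet Γ ℓ :=
  mem_levelSet.2 ⟨h, by simp [PropForm.altDepth, PropForm.altDepthAux]⟩

/-- The block children of a new `∨`-block lie one level down. [cite: Krajicek1995, Thm. 12.4.3 (proof)] -/
theorem dkids_subset_levelSet {Γ : Finset (PropForm ℕ)} (hΓ : SubClosed Γ) {ℓ : ℕ} {a b : PropForm ℕ}
    (hφ : PropForm.disj a b ∈ levelSet Γ (ℓ + 1)) : dkids (PropForm.disj a b) ⊆ levelSet Γ ℓ := by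
  intro c hc
  rw [mem_levelSet] at hφ ⊢
  have := altDepth_lt_of_mem_dkids_disj hc
  exact ⟨hΓ.dkids_subset hφ.1 hc, by omega⟩

/-- The block children of a new `∧`-block lie one level down. [cite: Krajicek1995, Thm. 12.4.3 (proof)] -/
theorem ckids_subset_levelSet {Γ : Finset (PropForm ℕ)} (hΓ : SubClosed Γ) {ℓ : ℕ} {a b : PropForm ℕ}
    (hφ : PropForm.conj a b ∈ levelSet Γ (ℓ + 1)) : ckids (PropForm.conj a b) ⊆ levelSet Γ ℓ := by
  intro c hc
  rw [mem_levelSet] at hφ ⊢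
  have := altDepth_lt_of_mem_ckids_conj hc
  exact ⟨hΓ.ckids_subset hφ.1 hc, by omega⟩

namespace KEval

variable {n k : ℕ} {ρ : Finset (ℕ × ℕ)}

/-! ### Level `0`: atoms and constants -/

open Classical in
/-- The systems of the canonical evaluation of depth-`0` formulas (extended by `S_{¬φ} = S_φ`
and `{∅}` elsewhere). [cite: Krajicek1995, Def. 12.4.1(3,4)] -/
noncomputable def baseS (n : ℕ) (ρ : Finset (ℕ × ℕ)) : PropForm ℕ → Finset (Finset (ℕ × ℕ))
  | .var v => if IsLiveAtom n ρ v then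
      atomSystem (Finset.range (n + 1) \ dom ρ) (Finset.range n \ rng ρ) (atomOf n v).1 (atomOf n v).2
      else {∅}
  | .neg φ => baseS n ρ φ
  | _ => {∅}

open Classical in
/-- The truth sets of the canonical evaluation of depth-`0` formulas. [cite: Krajicek1995, Def. 12.4.1(3,4)] -/
noncomputable def baseH (n : ℕ) (ρ : Finset (ℕ × ℕ)) : PropForm ℕ → Finset (Finset (ℕ × ℕ))
  | .var v => if IsLiveAtom n ρ v then {{atomOf n v}}
      else if atomOf n v ∈ ρ then baseS n ρ (.var v) else ∅
  | .const b => if b then {∅} else ∅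
  | .neg φ => baseS n ρ φ \ baseH n ρ φ
  | _ => ∅

/-- **The canonical `k`-evaluation of the depth-`0` formulas** (atoms and constants) of `Γ`
relative to any restriction `ρ` (`k ≥ 2`; Krajíček 1995, Thm. 12.4.3, the case `d = 1`).
[cite: Krajicek1995, Thm. 12.4.3 (proof, base case)] -/
noncomputable def base (n : ℕ) {ρ : Finset (ℕ × ℕ)} (hρ : IsPMatching ρ)
    (hρs : ρ ⊆ Finset.range (n + 1) ×ˢ Finset.range n) {k : ℕ} (hk : 2 ≤ k)
    (Γ : Finset (PropForm ℕ)) : KEval n ρ k (levelSet Γ 0) where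
  S := baseS n ρ
  H := baseH n ρ
  isPMatching := hρ
  ρ_subset := hρs
  complete φ hφ := by
    rw [mem_levelSet, Nat.le_zero] at hφ
    cases φ with
    | var v =>
      simp only [baseS]
      split_ifs with hl
      · obtain ⟨hx, hd, hr⟩ := hl
        obtain ⟨hi, hj⟩ := Finset.mem_product.1 (atomOf_mem_product hx)
        have hDR : (Finset.range n \ rng ρ).card ≤ (Finset.range (n + 1) \ dom ρ).card := by
          have h1 := card_restrictedDomain hρ hρs
          have h2 := card_restrictedRange hρ hρs
          rw [Finset.card_range] at h1 h2
          omega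
        exact (isKComplete_atomSystem (Finset.mem_sdiff.2 ⟨hi, hd⟩) (Finset.mem_sdiff.2 ⟨hj, hr⟩) hDR).mono hk
      · exact (isKComplete_singleton_empty _ _).mono (Nat.zero_le _)
    | const b => exact (isKComplete_singleton_empty _ _).mono (Nat.zero_le _)
    | neg φ => exact absurd hφ.2 (altDepth_pos_of_neg φ).ne'
    | conj a b => exact absurd hφ.2 (altDepth_pos_of_conj a b).ne'
    | disj a b => exact absurd hφ.2 (altDepth_pos_of_disj a b).ne'
  subset φ hφ := by
    rw [mem_levelSet, Nat.le_zero] at hφ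
    cases φ with
    | var v =>
      simp only [baseH, baseS]
      split_ifs with hl hmem
      · intro σ hσ; rw [Finset.mem_singleton] at hσ; rw [hσ]; exact mem_atomSystem.2 (Or.inl rfl)
      · exact le_rfl
      · exact Finset.empty_subset _
    | const b => cases b <;> simp [baseH, baseS]
    | neg φ => exact absurd hφ.2 (altDepth_pos_of_neg φ).ne'
    | conj a b => exact absurd hφ.2 (altDepth_pos_of_conj a b).ne'
    | disj a b => exact absurd hφ.2 (altDepth_pos_of_disj a b).ne'
  H_true _ := by simp [baseH, baseS]
  H_false _ := by simp [baseH]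
  live v _ hl := ⟨by rw [baseS, if_pos hl], by rw [baseH, if_pos hl]⟩
  setTrue v _ hmem := by
    have hl : ¬ IsLiveAtom n ρ v := fun h => h.2.1 (mem_dom.2 ⟨_, hmem⟩)
    simp only [baseH, if_neg hl, if_pos hmem]
  dead v _ hmem hl := by simp only [baseH, if_neg hl, if_neg hmem]
  neg_S φ _ := rfl
  neg_H φ _ := rfl
  disj_refines a b h := by
    rw [mem_levelSet, Nat.le_zero] at h; exact absurd h.2 (altDepth_pos_of_disj a b).ne'
  disj_H a b h := by
    rw [mem_levelSet, Nat.le_zero] at h; exact absurd h.2 (altDepth_pos_of_disj a b).ne'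
  conj_refines a b h := by
    rw [mem_levelSet, Nat.le_zero] at h; exact absurd h.2 (altDepth_pos_of_conj a b).ne'
  conj_H a b h := by
    rw [mem_levelSet, Nat.le_zero] at h; exact absurd h.2 (altDepth_pos_of_conj a b).ne'

/-! ### Extending an evaluation by one level -/

/-- The systems of the extension of `E` (an evaluation of `Γlo`) by the systems `Φ` chosen for
the new `∨`/`∧`-blocks. [cite: Krajicek1995, Thm. 12.4.3 (proof, inductive step)] -/
def extS {Γlo : Finset (PropForm ℕ)} (E : KEval n ρ k Γlo) (Φ : PropForm ℕ → Finset (Finset (ℕ × ℕ))) :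
    PropForm ℕ → Finset (Finset (ℕ × ℕ))
  | .neg φ => extS E Φ φ
  | .disj a b => if PropForm.disj a b ∈ Γlo then E.S (.disj a b) else Φ (.disj a b)
  | .conj a b => if PropForm.conj a b ∈ Γlo then E.S (.conj a b) else Φ (.conj a b)
  | φ => E.S φ

/-- The truth sets of the extension. [cite: Krajicek1995, Thm. 12.4.3 (proof, inductive step)] -/
def extH {Γlo : Finset (PropForm ℕ)} (E : KEval n ρ k Γlo) (Φ : PropForm ℕ → Finset (Finset (ℕ × ℕ))) :
    PropForm ℕ → Finset (Finset (ℕ × ℕ))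
  | .neg φ => extS E Φ φ \ extH E Φ φ
  | .const b => if b then E.S (.const b) else ∅
  | .disj a b => if PropForm.disj a b ∈ Γlo then E.H (.disj a b)
      else proj (Φ (.disj a b)) ((dkids (PropForm.disj a b)).biUnion E.H)
  | .conj a b => if PropForm.conj a b ∈ Γlo then E.H (.conj a b)
      else Φ (.conj a b) \ proj (Φ (.conj a b)) ((ckids (PropForm.conj a b)).biUnion fun ξ => E.S ξ \ E.H ξ)
  | .var v => E.H (.var v)

/-- On the old formulas the extension has the old systems. [folklore] -/
theorem extS_eq {Γlo : Finset (PropForm ℕ)} (E : KEval n ρ k Γlo) (hlo : SubClosed Γlo)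
    (Φ : PropForm ℕ → Finset (Finset (ℕ × ℕ))) : ∀ {φ : PropForm ℕ}, φ ∈ Γlo → extS E Φ φ = E.S φ
  | .var v, _ => rfl
  | .const b, _ => rfl
  | .neg φ, h => by rw [extS, extS_eq E hlo Φ (hlo.mem_of_neg h), E.neg_S φ h]
  | .disj a b, h => by simp [extS, h]
  | .conj a b, h => by simp [extS, h]

/-- On the old formulas the extension has the old truth sets. [folklore] -/
theorem extH_eq {Γlo : Finset (PropForm ℕ)} (E : KEval n ρ k Γlo) (hlo : SubClosed Γlo)
    (Φ : PropForm ℕ → Finset (Finset (ℕ × ℕ))) : ∀ {φ : PropForm ℕ}, φ ∈ Γlo → extH E Φ φ = E.H φ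
  | .var v, _ => rfl
  | .const true, h => by rw [extH, if_pos rfl, E.H_true h]
  | .const false, h => by rw [extH, E.H_false h]; rfl
  | .neg φ, h => by
    have hφ := hlo.mem_of_neg h
    rw [extH, extS_eq E hlo Φ hφ, extH_eq E hlo Φ hφ, E.neg_H φ h]
  | .disj a b, h => by simp [extH, h]
  | .conj a b, h => by simp [extH, h]

/-- **Extension by one level** (the inductive step of Krajíček 1995, Thm. 12.4.3): let `E` be a
`k`-evaluation of the subformula-closed `Γlo`, let `Γhi` be subformula-closed with all its
variables and constants in `Γlo`, and suppose every `∨`-block (`∧`-block) `φ ∈ Γhi ∖ Γlo` has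
its block children in `Γlo` and is given a `k`-complete system `Φ φ` refining `⋃ᵢ H_{φᵢ}`
(`⋃ᵢ (S_{φᵢ} ∖ H_{φᵢ})`). Then `Γhi` has a `k`-evaluation extending `E`.
[cite: Krajicek1995, Thm. 12.4.3 (proof, inductive step)] -/
def extend {Γlo Γhi : Finset (PropForm ℕ)} (E : KEval n ρ k Γlo) (hlo : SubClosed Γlo)
    (hhi : SubClosed Γhi)
    (hvar : ∀ v, PropForm.var v ∈ Γhi → PropForm.var v ∈ Γlo)
    (hconst : ∀ b, PropForm.const b ∈ Γhi → PropForm.const b ∈ Γlo)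
    (Φ : PropForm ℕ → Finset (Finset (ℕ × ℕ)))
    (hdisj : ∀ a b, PropForm.disj a b ∈ Γhi → PropForm.disj a b ∉ Γlo →
      dkids (PropForm.disj a b) ⊆ Γlo ∧
      IsKComplete (Finset.range (n + 1) \ dom ρ) (Finset.range n \ rng ρ) k (Φ (.disj a b)) ∧
      Refines ((dkids (PropForm.disj a b)).biUnion E.H) (Φ (.disj a b)))
    (hconj : ∀ a b, PropForm.conj a b ∈ Γhi → PropForm.conj a b ∉ Γlo →
      ckids (PropForm.conj a b) ⊆ Γlo ∧
      IsKComplete (Finset.range (n + 1) \ dom ρ) (Finset.range n \ rng ρ) k (Φ (.conj a b)) ∧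
      Refines ((ckids (PropForm.conj a b)).biUnion fun ξ => E.S ξ \ E.H ξ) (Φ (.conj a b))) :
    KEval n ρ k Γhi where
  S := extS E Φ
  H := extH E Φ
  isPMatching := E.isPMatching
  ρ_subset := E.ρ_subset
  complete := by
    suffices h : ∀ φ, φ ∈ Γhi →
        IsKComplete (Finset.range (n + 1) \ dom ρ) (Finset.range n \ rng ρ) k (extS E Φ φ) from h
    intro φ
    induction φ with
    | var v => intro h; exact E.complete _ (hvar v h)
    | const b => intro h; exact E.complete _ (hconst b h)
    | neg φ ih => intro h; rw [extS]; exact ih (hhi.mem_of_neg h)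
    | disj a b _ _ =>
      intro h
      by_cases hm : PropForm.disj a b ∈ Γlo
      · rw [extS, if_pos hm]; exact E.complete _ hm
      · rw [extS, if_neg hm]; exact (hdisj a b h hm).2.1
    | conj a b _ _ =>
      intro h
      by_cases hm : PropForm.conj a b ∈ Γlo
      · rw [extS, if_pos hm]; exact E.complete _ hm
      · rw [extS, if_neg hm]; exact (hconj a b h hm).2.1
  subset := by
    suffices h : ∀ φ, φ ∈ Γhi → extH E Φ φ ⊆ extS E Φ φ from h
    intro φ
    induction φ with
    | var v => intro h; exact E.subset _ (hvar v h)
    | const b =>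
      intro h
      show (if b then E.S (.const b) else ∅) ⊆ E.S (.const b)
      split_ifs
      · exact le_rfl
      · exact Finset.empty_subset _
    | neg φ _ => intro _; rw [extH, extS]; exact Finset.sdiff_subset
    | disj a b _ _ =>
      intro h
      by_cases hm : PropForm.disj a b ∈ Γlo
      · rw [extH, extS, if_pos hm, if_pos hm]; exact E.subset _ hm
      · rw [extH, extS, if_neg hm, if_neg hm]; exact proj_subset _ _
    | conj a b _ _ =>
      intro h
      by_cases hm : PropForm.conj a b ∈ Γlo
      · rw [extH, extS, if_pos hm, if_pos hm]; exact E.subset _ hm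
      · rw [extH, extS, if_neg hm, if_neg hm]; exact Finset.sdiff_subset
  H_true _ := by rw [extH, if_pos rfl]; rfl
  H_false _ := rfl
  live v hv hl := E.live v (hvar v hv) hl
  setTrue v hv hmem := E.setTrue v (hvar v hv) hmem
  dead v hv hmem hl := E.dead v (hvar v hv) hmem hl
  neg_S φ _ := rfl
  neg_H φ _ := rfl
  disj_refines a b h := by
    by_cases hm : PropForm.disj a b ∈ Γlo
    · have hparts := hlo.dkids_subset hm
      rw [extS, if_pos hm, Finset.biUnion_congr rfl (fun c hc => extH_eq E hlo Φ (hparts hc))]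
      exact E.disj_refines a b hm
    · obtain ⟨hparts, -, href⟩ := hdisj a b h hm
      rw [extS, if_neg hm, Finset.biUnion_congr rfl (fun c hc => extH_eq E hlo Φ (hparts hc))]
      exact href
  disj_H a b h := by
    by_cases hm : PropForm.disj a b ∈ Γlo
    · have hparts := hlo.dkids_subset hm
      rw [extH, extS, if_pos hm, if_pos hm,
        Finset.biUnion_congr rfl (fun c hc => extH_eq E hlo Φ (hparts hc))]
      exact E.disj_H a b hm
    · obtain ⟨hparts, -, -⟩ := hdisj a b h hm
      rw [extH, extS, if_neg hm, if_neg hm,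
        Finset.biUnion_congr rfl (fun c hc => extH_eq E hlo Φ (hparts hc))]
  conj_refines a b h := by
    have e : ∀ (hparts : ckids (PropForm.conj a b) ⊆ Γlo),
        ((ckids (PropForm.conj a b)).biUnion fun ξ => extS E Φ ξ \ extH E Φ ξ) =
          (ckids (PropForm.conj a b)).biUnion fun ξ => E.S ξ \ E.H ξ := fun hparts =>
      Finset.biUnion_congr rfl (fun c hc =>
        show extS E Φ c \ extH E Φ c = E.S c \ E.H c by
          rw [extS_eq E hlo Φ (hparts hc), extH_eq E hlo Φ (hparts hc)])
    by_cases hm : PropForm.conj a b ∈ Γlo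
    · rw [extS, if_pos hm, e (hlo.ckids_subset hm)]
      exact E.conj_refines a b hm
    · obtain ⟨hparts, -, href⟩ := hconj a b h hm
      rw [extS, if_neg hm, e hparts]
      exact href
  conj_H a b h := by
    have e : ∀ (hparts : ckids (PropForm.conj a b) ⊆ Γlo),
        ((ckids (PropForm.conj a b)).biUnion fun ξ => extS E Φ ξ \ extH E Φ ξ) =
          (ckids (PropForm.conj a b)).biUnion fun ξ => E.S ξ \ E.H ξ := fun hparts =>
      Finset.biUnion_congr rfl (fun c hc =>
        show extS E Φ c \ extH E Φ c = E.S c \ E.H c by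
          rw [extS_eq E hlo Φ (hparts hc), extH_eq E hlo Φ (hparts hc)])
    by_cases hm : PropForm.conj a b ∈ Γlo
    · rw [extH, extS, if_pos hm, if_pos hm, e (hlo.ckids_subset hm)]
      exact E.conj_H a b hm
    · obtain ⟨hparts, -, -⟩ := hconj a b h hm
      rw [extH, extS, if_neg hm, if_neg hm, e hparts]

end KEval

end Literature.Computability.MetaComplexity


namespace Literature.Computability.MetaComplexity

open Complexity Complexity.PropForm PBij

/-! ### The integer parameter schedule -/

/-- The number `w` of pairs restricted at a level after which `m` holes remain free (with
switching threshold `s`, norm `k = 2s`): large enough for the counting inequality of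
`PBij.php_switching` with `N ≤ 2^{s+1}` sets (`bump_ineq`). [cite: Krajicek1995, Thm. 12.4.3 (proof: choice of w = m − m^ε)] -/
def bump (m s : ℕ) : ℕ :=
  2 * ((2 * s + 1) * ((m + 2 * s + 1) * (m + 2 * s + 1)) * 2) * ((m + 1) * m) * (s + 1)

/-- The number of free holes when `j` levels remain to be treated, ending with `base` free holes:
`levelSize s base 0 = base`, `levelSize s base (j+1) = levelSize s base j + bump (levelSize s base j) s`.
[cite: Krajicek1995, Thm. 12.4.3 (proof: the schedule n^{ε^{d-1}})] -/
def levelSize (s base : ℕ) : ℕ → ℕ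
  | 0 => base
  | j + 1 => levelSize s base j + bump (levelSize s base j) s

/-- The schedule never goes below `base`. [folklore] -/
theorem base_le_levelSize (s base : ℕ) : ∀ j, base ≤ levelSize s base j
  | 0 => le_rfl
  | j + 1 => (base_le_levelSize s base j).trans (Nat.le_add_right _ _)

/-- The schedule is monotone in the number of remaining levels. [folklore] -/
theorem levelSize_le_succ (s base j : ℕ) : levelSize s base j ≤ levelSize s base (j + 1) :=
  Nat.le_add_right _ _

/-- `n! ≤ n^n`. [folklore] -/
theorem factorial_le_pow_self : ∀ n : ℕ, n.factorial ≤ n ^ n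
  | 0 => le_rfl
  | n + 1 => by
    rw [Nat.factorial_succ, Nat.pow_succ']
    exact Nat.mul_le_mul_left _ ((factorial_le_pow_self n).trans (Nat.pow_le_pow_left (Nat.le_succ n) n))

/-- A binomial lower bound: `(w+1)^{s+1} ≤ (s+1)! · C(w+s+1, s+1)` (from Mathlib's
`Nat.pow_le_choose`). [folklore] -/
theorem pow_succ_le_factorial_mul_choose (w s : ℕ) :
    (w + 1) ^ (s + 1) ≤ (s + 1).factorial * Nat.choose (w + s + 1) (s + 1) := by
  have h := Nat.pow_le_choose (α := ℚ) (s + 1) (w + s + 1)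
  have e : w + s + 1 + 1 - (s + 1) = w + 1 := by omega
  rw [e, div_le_iff₀ (by positivity), mul_comm] at h
  exact_mod_cast h

/-- **The counting inequality of the switching lemma holds along the schedule**: with
`w = bump m s` and at most `2^{s+1}` sets,
`2^{s+1} · ((2s+1)(m+2s+1)² · 2)^{s+1} · ((m+1)m)^{s+1} < C(w+s+1, w)`.
[cite: Krajicek1995, Lemma 12.3.10 ("In particular, for … the inequality is satisfied")] -/
theorem bump_ineq (m s : ℕ) :
    2 ^ (s + 1) * ((2 * s + 1) * ((m + 2 * s + 1) * (m + 2 * s + 1)) * 2) ^ (s + 1) *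
      ((m + 1) * m) ^ (s + 1) < Nat.choose (bump m s + s + 1) (bump m s) := by
  have hw : bump m s = 2 * ((2 * s + 1) * ((m + 2 * s + 1) * (m + 2 * s + 1)) * 2) * ((m + 1) * m) * (s + 1) :=
    rfl
  rw [hw]
  generalize (2 * s + 1) * ((m + 2 * s + 1) * (m + 2 * s + 1)) * 2 = X
  generalize (m + 1) * m = Y
  generalize hwXY : 2 * X * Y * (s + 1) = w
  -- `C(w+s+1, w) = C(w+s+1, s+1) ≥ (w+1)^{s+1} / (s+1)!`
  have hsymm : Nat.choose (w + s + 1) w = Nat.choose (w + s + 1) (s + 1) := by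
    rw [show w + s + 1 = w + (s + 1) by omega]; exact Nat.choose_symm_add
  rw [hsymm]
  have hlow := pow_succ_le_factorial_mul_choose w s
  have hfac : (s + 1).factorial ≤ (s + 1) ^ (s + 1) := factorial_le_pow_self (s + 1)
  -- `(s+1)^{s+1} · LHS = w^{s+1} < (w+1)^{s+1}`
  have hkey : (s + 1) ^ (s + 1) * (2 ^ (s + 1) * X ^ (s + 1) * Y ^ (s + 1)) = w ^ (s + 1) := by
    rw [← hwXY, mul_pow, mul_pow, mul_pow]; ring
  have hlt : w ^ (s + 1) < (w + 1) ^ (s + 1) := Nat.pow_lt_pow_left (Nat.lt_succ_self w) (Nat.succ_ne_zero s)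
  -- cancel the positive factor `(s+1)^{s+1}`
  by_contra hcon
  rw [not_lt] at hcon
  have h1 : (s + 1) ^ (s + 1) * Nat.choose (w + s + 1) (s + 1) ≤
      (s + 1) ^ (s + 1) * (2 ^ (s + 1) * X ^ (s + 1) * Y ^ (s + 1)) := Nat.mul_le_mul_left _ hcon
  have h2 : (s + 1).factorial * Nat.choose (w + s + 1) (s + 1) ≤
      (s + 1) ^ (s + 1) * Nat.choose (w + s + 1) (s + 1) := Nat.mul_le_mul_right _ hfac
  omega

/-! ### Recognising disjunctions and conjunctions -/

section Shape

variable {ν : Type*}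

/-- Is the formula a disjunction? [folklore] -/
def isDisj : PropForm ν → Bool
  | .disj _ _ => true
  | _ => false

/-- Is the formula a conjunction? [folklore] -/
def isConj : PropForm ν → Bool
  | .conj _ _ => true
  | _ => false

/-- Specification of `isDisj`. [folklore] -/
theorem isDisj_iff {φ : PropForm ν} : isDisj φ = true ↔ ∃ a b, φ = .disj a b := by
  cases φ <;> simp [isDisj]

/-- Specification of `isConj`. [folklore] -/
theorem isConj_iff {φ : PropForm ν} : isConj φ = true ↔ ∃ a b, φ = .conj a b := by
  cases φ <;> simp [isConj]

end Shape

namespace KEval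

variable {n k : ℕ} {ρ : Finset (ℕ × ℕ)} {Γ : Finset (PropForm ℕ)}

/-- The set handed to the switching lemma for a new block: `⋃ᵢ H_{φᵢ}` for a disjunction,
`⋃ᵢ (S_{φᵢ} ∖ H_{φᵢ})` otherwise. [cite: Krajicek1995, Thm. 12.4.3 (proof, inductive step)] -/
def blockSet (E : KEval n ρ k Γ) (φ : PropForm ℕ) : Finset (Finset (ℕ × ℕ)) :=
  if isDisj φ then E.dU φ else E.cU φ

/-- Elements of the block set of a formula whose block members are evaluated are matchings of
the free universe of norm `≤ k`. [folklore] -/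
theorem blockSet_spec (E : KEval n ρ k Γ) {φ : PropForm ℕ}
    (hd : isDisj φ = true → dkids φ ⊆ Γ) (hc : isDisj φ = false → ckids φ ⊆ Γ) :
    ∀ h ∈ E.blockSet φ, IsPMatching h ∧ h ⊆ (Finset.range (n + 1) \ dom ρ) ×ˢ (Finset.range n \ rng ρ) ∧
      h.card ≤ k := by
  intro h hh
  unfold blockSet at hh
  split_ifs at hh with hdisj
  · rw [KEval.dU, Finset.mem_biUnion] at hh
    obtain ⟨c, hcm, hh⟩ := hh
    have hcΓ := hd hdisj hcm
    have hcomp := E.complete c hcΓ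
    have hS := E.subset c hcΓ hh
    exact ⟨hcomp.isPMatching h hS, hcomp.subset h hS, hcomp.card_le h hS⟩
  · rw [KEval.cU, Finset.mem_biUnion] at hh
    obtain ⟨c, hcm, hh⟩ := hh
    have hcΓ := hc (by simpa using hdisj) hcm
    have hcomp := E.complete c hcΓ
    have hS := Finset.sdiff_subset hh
    exact ⟨hcomp.isPMatching h hS, hcomp.subset h hS, hcomp.card_le h hS⟩

/-- Restricting the block set of a disjunction. [cite: Krajicek1995, Lemma 12.4.2] -/
theorem restrict_dU (E : KEval n ρ k Γ) (ρ' : Finset (ℕ × ℕ)) (φ : PropForm ℕ) :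
    PBij.restrict ρ' (E.dU φ) = (dkids φ).biUnion fun c => PBij.restrict ρ' (E.H c) := by
  rw [KEval.dU, restrict_biUnion]

/-- Restricting the block set of a conjunction (with evaluated members). [cite: Krajicek1995, Lemma 12.4.2] -/
theorem restrict_cU (E : KEval n ρ k Γ) (ρ' : Finset (ℕ × ℕ)) {φ : PropForm ℕ}
    (hparts : ckids φ ⊆ Γ) :
    PBij.restrict ρ' (E.cU φ) =
      (ckids φ).biUnion fun c => PBij.restrict ρ' (E.S c) \ PBij.restrict ρ' (E.H c) := by
  rw [KEval.cU, restrict_biUnion]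
  refine Finset.biUnion_congr rfl fun c hc => ?_
  have hcΓ := hparts hc
  rw [restrict_sdiff (E.complete c hcΓ) (E.subset c hcΓ)]

end KEval

/-! ### The level recursion (Krajíček 1995, Thm. 12.4.3) -/

/-- **Thm. 12.4.3, level by level** (Krajíček 1995; KPW 1995): for `1 ≤ s`, a subformula-closed
`Γ` with `|Γ| ≤ 2^{s+1}` and `s + 1 ≤ base`, if some restriction leaves exactly
`levelSize s base d` holes free, then for every `ℓ ≤ d` some restriction `ρ` leaves exactly
`levelSize s base (d - ℓ)` holes free and the formulas of `Γ` of depth `≤ ℓ` admit a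
`2s`-evaluation relative to `ρ`. [cite: Krajicek1995, Thm. 12.4.3] -/
theorem exists_kEval_levels {n s base d : ℕ} (hs : 1 ≤ s) (hbase : s + 1 ≤ base)
    {Γ : Finset (PropForm ℕ)} (hΓ : SubClosed Γ) (hcard : Γ.card ≤ 2 ^ (s + 1))
    {ρ₀ : Finset (ℕ × ℕ)} (hρ₀ : IsPMatching ρ₀) (hρ₀s : ρ₀ ⊆ Finset.range (n + 1) ×ˢ Finset.range n)
    (hρ₀c : (Finset.range n \ rng ρ₀).card = levelSize s base d) :
    ∀ ℓ ≤ d, ∃ ρ : Finset (ℕ × ℕ), IsPMatching ρ ∧ ρ ⊆ Finset.range (n + 1) ×ˢ Finset.range n ∧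
      (Finset.range n \ rng ρ).card = levelSize s base (d - ℓ) ∧ Nonempty (KEval n ρ (2 * s) (levelSet Γ ℓ)) := by
  intro ℓ
  induction ℓ with
  | zero =>
    intro _
    exact ⟨ρ₀, hρ₀, hρ₀s, by rw [Nat.sub_zero]; exact hρ₀c, ⟨KEval.base n hρ₀ hρ₀s (by omega) Γ⟩⟩
  | succ ℓ ih =>
    intro hℓ
    obtain ⟨ρ, hρ, hρs, hρc, ⟨E⟩⟩ := ih (Nat.le_of_succ_le hℓ)
    -- sizes
    set m := levelSize s base (d - (ℓ + 1)) with hm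
    set w := bump m s with hwdef
    have hsz : (Finset.range n \ rng ρ).card = m + w := by
      rw [hρc, show d - ℓ = d - (ℓ + 1) + 1 by omega, levelSize]
    have hmb : s + 1 ≤ m := hbase.trans (base_le_levelSize s base _)
    set D := Finset.range (n + 1) \ dom ρ with hD
    set R := Finset.range n \ rng ρ with hR
    have hDR : D.card = R.card + 1 := E.card_D
    -- the new blocks and their sets
    have hlo := subClosed_levelSet hΓ ℓ
    have hhi := subClosed_levelSet hΓ (ℓ + 1)
    set NF := ((levelSet Γ (ℓ + 1)).filter fun φ => φ ∉ levelSet Γ ℓ ∧ (isDisj φ = true ∨ isConj φ = true))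
      with hNF
    set L := NF.toList with hLdef
    set N := L.length with hNdef
    have hN : N ≤ 2 ^ (s + 1) := by
      rw [hNdef, hLdef, Finset.length_toList]
      exact (Finset.card_le_card ((Finset.filter_subset _ _).trans (Finset.filter_subset _ _))).trans hcard
    have hmemNF : ∀ {φ}, φ ∈ NF ↔ φ ∈ levelSet Γ (ℓ + 1) ∧ φ ∉ levelSet Γ ℓ ∧ (isDisj φ = true ∨ isConj φ = true) := by
      intro φ; rw [hNF, Finset.mem_filter]
    let Ls : ℕ → List (Finset (ℕ × ℕ)) := fun i => (E.blockSet (L.getD i (PropForm.const true))).toList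
    have hL : ∀ i < N, ∀ h ∈ Ls i, IsPMatching h ∧ h ⊆ D ×ˢ R ∧ h.card ≤ 2 * s := by
      intro i hi h hh
      have hφL : L.getD i (PropForm.const true) ∈ L := by
        rw [List.getD_eq_getElem _ _ hi]; exact List.getElem_mem hi
      rw [hLdef, Finset.mem_toList] at hφL
      obtain ⟨hφhi, -, hshape⟩ := hmemNF.1 hφL
      rw [Finset.mem_toList] at hh
      refine E.blockSet_spec (fun hdj => ?_) (fun hdj => ?_) h hh
      · obtain ⟨a, b, hab⟩ := isDisj_iff.1 hdj
        rw [hab] at hφhi ⊢; exact dkids_subset_levelSet hΓ hφhi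
      · generalize L.getD i (PropForm.const true) = φ at hφhi hdj hshape ⊢
        cases φ with
        | conj a b => exact ckids_subset_levelSet hΓ hφhi
        | disj a b => simp [isDisj] at hdj
        | _ => simp [isDisj, isConj] at hshape
    -- the switching lemma
    have hineq : N * ((2 * s + 1) * ((R.card + 2 * s - w + 1) * (R.card + 2 * s - w + 1)) * 2) ^ (s + 1) *
        ((D.card - w) * (R.card - w)) ^ (s + 1) < Nat.choose (w + s + 1) w := by
      have e1 : R.card + 2 * s - w + 1 = m + 2 * s + 1 := by rw [hsz]; omega
      have e2 : D.card - w = m + 1 := by rw [hDR, hsz]; omega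
      have e3 : R.card - w = m := by rw [hsz]; omega
      rw [e1, e2, e3]
      calc N * ((2 * s + 1) * ((m + 2 * s + 1) * (m + 2 * s + 1)) * 2) ^ (s + 1) * ((m + 1) * m) ^ (s + 1)
          ≤ 2 ^ (s + 1) * ((2 * s + 1) * ((m + 2 * s + 1) * (m + 2 * s + 1)) * 2) ^ (s + 1) *
              ((m + 1) * m) ^ (s + 1) :=
            Nat.mul_le_mul_right _ (Nat.mul_le_mul_right _ hN)
        _ < _ := bump_ineq m s
    obtain ⟨ρ', hρ', hρ's, hρ'c, hsys⟩ :=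
      php_switching hDR Ls N (2 * s) w s hL (by rw [hsz]; omega) hineq
    choose! Sf hSf using hsys
    -- the restricted old evaluation and the new one
    let E' := E.restrict hlo hρ' hρ's
    let Φ : PropForm ℕ → Finset (Finset (ℕ × ℕ)) := fun φ => Sf (L.idxOf φ)
    have huniv : Finset.range (n + 1) \ dom (ρ ∪ ρ') = D \ dom ρ' ∧ Finset.range n \ rng (ρ ∪ ρ') = R \ rng ρ' :=
      ⟨E.D_sdiff.symm, E.R_sdiff.symm⟩
    have hnew : ∀ φ, φ ∈ levelSet Γ (ℓ + 1) → φ ∉ levelSet Γ ℓ → (isDisj φ = true ∨ isConj φ = true) →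
        L.idxOf φ < N ∧ L.getD (L.idxOf φ) (PropForm.const true) = φ := by
      intro φ h1 h2 h3
      have hφL : φ ∈ L := by rw [hLdef, Finset.mem_toList]; exact hmemNF.2 ⟨h1, h2, h3⟩
      have hlt : L.idxOf φ < L.length := List.idxOf_lt_length_of_mem hφL
      exact ⟨hlt, by rw [List.getD_eq_getElem _ _ hlt, List.getElem_idxOf hlt]⟩
    have E'' : KEval n (ρ ∪ ρ') (2 * s) (levelSet Γ (ℓ + 1)) := by
      refine E'.extend hlo hhi (fun v hv => var_mem_levelSet (mem_levelSet.1 hv).1)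
        (fun b hb => const_mem_levelSet (mem_levelSet.1 hb).1) Φ (fun a b h hm => ?_) (fun a b h hm => ?_)
      · have hparts := dkids_subset_levelSet hΓ h
        obtain ⟨hi, hget⟩ := hnew _ h hm (Or.inl rfl)
        obtain ⟨hcomp, href⟩ := hSf _ hi
        refine ⟨hparts, ?_, ?_⟩
        · rw [huniv.1, huniv.2]; exact hcomp
        · have : (Ls (L.idxOf (PropForm.disj a b))).toFinset = E.dU (.disj a b) := by
            show (E.blockSet (L.getD (L.idxOf (PropForm.disj a b)) (PropForm.const true))).toList.toFinset = _
            rw [hget, Finset.toList_toFinset]; simp [KEval.blockSet, isDisj]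
          rw [this, E.restrict_dU] at href
          exact href
      · have hparts := ckids_subset_levelSet hΓ h
        obtain ⟨hi, hget⟩ := hnew _ h hm (Or.inr rfl)
        obtain ⟨hcomp, href⟩ := hSf _ hi
        refine ⟨hparts, ?_, ?_⟩
        · rw [huniv.1, huniv.2]; exact hcomp
        · have : (Ls (L.idxOf (PropForm.conj a b))).toFinset = E.cU (.conj a b) := by
            show (E.blockSet (L.getD (L.idxOf (PropForm.conj a b)) (PropForm.const true))).toList.toFinset = _
            rw [hget, Finset.toList_toFinset]; simp [KEval.blockSet, isDisj]
          rw [this, E.restrict_cU ρ' hparts] at href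
          exact href
    -- the new restriction
    refine ⟨ρ ∪ ρ', ?_, ?_, ?_, ⟨E''⟩⟩
    · exact compat_of_subset_restrictedUniverse hρ hρ' hρ's
    · refine Finset.union_subset hρs (hρ's.trans ?_)
      exact Finset.product_subset_product Finset.sdiff_subset Finset.sdiff_subset
    · rw [huniv.2]
      have h1 := card_restrictedRange hρ' hρ's (D := D)
      omega

/-- **Thm. 12.4.3** (Krajíček 1995; Krajíček–Pudlák–Woods 1995; cf. Krajíček 2019,
Lemma 15.2.3), integer form: for `1 ≤ s ≤ base - 1`, every subformula-closed set `Γ` of at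
most `2^{s+1}` formulas of alternation depth `≤ d` over the variables of `PHP^{n+1}_n` with
`levelSize s base d ≤ n` admits, after a restriction `ρ` leaving exactly `base` holes free, a
`2s`-evaluation relative to `ρ`. [cite: Krajicek1995, Thm. 12.4.3] -/
theorem exists_restriction_kEval {n s base d : ℕ} (hs : 1 ≤ s) (hbase : s + 1 ≤ base)
    {Γ : Finset (PropForm ℕ)} (hΓ : SubClosed Γ) (hcard : Γ.card ≤ 2 ^ (s + 1))
    (hdepth : ∀ φ ∈ Γ, φ.altDepth ≤ d) (hn : levelSize s base d ≤ n) :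
    ∃ ρ : Finset (ℕ × ℕ), IsPMatching ρ ∧ ρ ⊆ Finset.range (n + 1) ×ˢ Finset.range n ∧
      (Finset.range n \ rng ρ).card = base ∧ Nonempty (KEval n ρ (2 * s) Γ) := by
  -- an initial restriction cutting the universe down to `levelSize s base d` holes
  obtain ⟨P, hP, hPc⟩ := Finset.exists_subset_card_eq (s := Finset.range (n + 1))
    (n := n - levelSize s base d) (by rw [Finset.card_range]; omega)
  obtain ⟨ρ₀, hρ₀, hdom, hrng⟩ := exists_matching_left P (Finset.range n)
    (by rw [hPc, Finset.card_range]; omega)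
  have hρ₀s : ρ₀ ⊆ Finset.range (n + 1) ×ˢ Finset.range n := fun p hp =>
    Finset.mem_product.2 ⟨hP (hdom ▸ mem_dom.2 ⟨p.2, hp⟩), hrng (mem_rng.2 ⟨p.1, hp⟩)⟩
  have hρ₀c : (Finset.range n \ rng ρ₀).card = levelSize s base d := by
    have h1 := card_restrictedRange hρ₀ hρ₀s (D := Finset.range (n + 1))
    rw [Finset.card_range, ← hρ₀.card_dom, hdom, hPc] at h1
    omega
  obtain ⟨ρ, hρ, hρs, hρc, ⟨E⟩⟩ := exists_kEval_levels hs hbase hΓ hcard hρ₀ hρ₀s hρ₀c d le_rfl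
  rw [Nat.sub_self] at hρc
  refine ⟨ρ, hρ, hρs, hρc, ⟨?_⟩⟩
  rw [levelSet_eq_self hdepth] at E
  exact E

end Literature.Computability.MetaComplexity


namespace Literature.Computability.MetaComplexity

open Complexity Complexity.PropForm PBij

/-! ### From a proof to its set of subformulas -/

/-- The set `Γ` of all subformulas of the lines of a proof. [cite: Krajicek1995, Thm. 12.5.3 (proof: "Take Γ to be the set of the formulas occurring in π as subformulas")] -/
noncomputable def subformSet (π : List (PropForm ℕ)) : Finset (PropForm ℕ) :=
  (π.flatMap fun ψ => (subforms ψ).toList).toFinset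

/-- Membership in the subformula set. [folklore] -/
theorem mem_subformSet {π : List (PropForm ℕ)} {φ : PropForm ℕ} :
    φ ∈ subformSet π ↔ ∃ ψ ∈ π, φ ∈ subforms ψ := by
  rw [subformSet, List.mem_toFinset, List.mem_flatMap]
  simp only [Finset.mem_toList]

/-- The subformula set is closed under subformulas. [folklore] -/
theorem subClosed_subformSet (π : List (PropForm ℕ)) : SubClosed (subformSet π) := by
  intro φ hφ χ hχ
  obtain ⟨ψ, hψ, hφψ⟩ := mem_subformSet.1 hφ
  exact mem_subformSet.2 ⟨ψ, hψ, subforms_subset_of_mem hφψ hχ⟩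

/-- Lines belong to the subformula set. [folklore] -/
theorem mem_subformSet_of_mem {π : List (PropForm ℕ)} {ψ : PropForm ℕ} (h : ψ ∈ π) : ψ ∈ subformSet π :=
  mem_subformSet.2 ⟨ψ, h, self_mem_subforms ψ⟩

/-- **`|Γ| ≤` size of the proof** (Krajíček: "trivial `|π| ≥ |Γ|`"). [cite: Krajicek1995, Thm. 12.5.3 (proof, last paragraph)] -/
theorem card_subformSet_le (π : List (PropForm ℕ)) : (subformSet π).card ≤ proofSize π := by
  refine (List.toFinset_card_le _).trans ?_
  rw [List.length_flatMap, proofSize]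
  simp only [Finset.length_toList]
  induction π with
  | nil => simp
  | cons ψ π ih =>
    simp only [List.map_cons, List.sum_cons]
    exact Nat.add_le_add (card_subforms_le_size ψ) ih

/-- The depth of subformulas of the lines of a depth-`d` proof is at most `d`. [folklore] -/
theorem altDepth_le_of_mem_subformSet {π : List (PropForm ℕ)} {d : ℕ} (hπ : ∀ ψ ∈ π, ψ.altDepth ≤ d)
    {φ : PropForm ℕ} (hφ : φ ∈ subformSet π) : φ.altDepth ≤ d := by
  obtain ⟨ψ, hψ, hφψ⟩ := mem_subformSet.1 hφ
  exact (altDepth_le_of_mem_subforms hφψ).trans (hπ ψ hψ)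

/-! ### No small bounded-depth proofs of PHP: the numeric core of Thm. 12.5.3 -/

/-- The number of free holes kept at the end of the construction, as a function of the
switching threshold `s`: enough for `KEval.not_isProofOf_pigeonhole` (`18 k + 3 ≤ base` with
`k = 2s`) and for the switching lemma (`s + 1 ≤ base`). [cite: Krajicek1995, Thm. 12.5.3 (proof: k ≤ n^ρ/f and k ≤ n^ρ/2 − 3)] -/
def baseOf (s : ℕ) : ℕ :=
  37 * (s + 1) + 3

/-- `baseOf` leaves enough room. [folklore] -/
theorem baseOf_spec (s : ℕ) : s + 1 ≤ baseOf s ∧ 18 * (2 * s) + 3 ≤ baseOf s := by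
  unfold baseOf; omega

/-- **Theorem 12.5.3, numeric form** (Krajíček 1995; Ajtai 1988; Beame et al. 1992;
Krajíček–Pudlák–Woods 1995), for the concrete Frege system `textbookFrege` and the tautology
`pigeonholeForm (n+1) n`: if `1 ≤ s` and `levelSize s (baseOf s) d ≤ n`, then every depth-`d`
`textbookFrege`-proof of `¬PHP^{n+1}_n` has size greater than `2^{s+1}`. (Take `Γ` = all
subformulas of the proof; if `|Γ| ≤ 2^{s+1}`, Thm. 12.4.3 gives a restriction and a
`2s`-evaluation of `Γ`; by Lemma 12.4.4 all lines are true w.r.t. it, by Lemma 12.5.2 the last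
line is not — contradiction.) [cite: Krajicek1995, Thm. 12.5.3] -/
theorem lt_proofSize_of_isDepthProofOf_pigeonholeForm {d s n : ℕ} (hs : 1 ≤ s)
    (hn : levelSize s (baseOf s) d ≤ n) {π : List (PropForm ℕ)}
    (hπ : textbookFrege.IsDepthProofOf d π (pigeonholeForm (n + 1) n)) : 2 ^ (s + 1) < proofSize π := by
  by_contra hle
  rw [not_lt] at hle
  obtain ⟨hb1, hb2⟩ := baseOf_spec s
  set Γ := subformSet π with hΓdef
  have hΓ : SubClosed Γ := subClosed_subformSet π
  have hcard : Γ.card ≤ 2 ^ (s + 1) := (card_subformSet_le π).trans hle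
  have hdepth : ∀ φ ∈ Γ, φ.altDepth ≤ d := fun φ hφ => altDepth_le_of_mem_subformSet hπ.2 hφ
  obtain ⟨ρ, hρ, hρs, hρc, ⟨E⟩⟩ := exists_restriction_kEval hs hb1 hΓ hcard hdepth hn
  exact E.not_isProofOf_pigeonhole hΓ (by rw [show E.R.card = baseOf s from hρc]; exact hb2)
    (fun ψ hψ => mem_subformSet_of_mem hψ) hπ.1

/-! ### Polynomial growth of the schedule -/

/-- `bump m s ≤ 4 (m + 2s + 2)^6`. [folklore] -/
theorem bump_le (m s : ℕ) : bump m s ≤ 4 * (m + 2 * s + 2) ^ 6 := by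
  unfold bump
  set T := m + 2 * s + 2 with hT
  have h1 : 2 * s + 1 ≤ T := by omega
  have h2 : m + 2 * s + 1 ≤ T := by omega
  have h3 : m + 1 ≤ T := by omega
  have h4 : m ≤ T := by omega
  have h5 : s + 1 ≤ T := by omega
  calc 2 * ((2 * s + 1) * ((m + 2 * s + 1) * (m + 2 * s + 1)) * 2) * ((m + 1) * m) * (s + 1)
      ≤ 2 * (T * (T * T) * 2) * (T * T) * T := by gcongr
    _ = 4 * T ^ 6 := by ring

/-- One step of the schedule is polynomially bounded. [folklore] -/
theorem levelSize_succ_le (s base j : ℕ) :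
    levelSize s base (j + 1) ≤ 5 * (levelSize s base j + 2 * s + 2) ^ 6 := by
  rw [levelSize]
  have h := bump_le (levelSize s base j) s
  set T := levelSize s base j + 2 * s + 2
  have hT : levelSize s base j ≤ T := by omega
  have hT1 : 1 ≤ T := by omega
  have hT6 : T ≤ T ^ 6 := by
    calc T = T ^ 1 := (pow_one T).symm
      _ ≤ T ^ 6 := Nat.pow_le_pow_right hT1 (by norm_num)
  omega

/-- **The schedule is polynomial in `s`**: for every depth `d` there are `A, B ≥ 1` with
`levelSize s (baseOf s) d ≤ A (s+1)^B` for all `s`. [cite: Krajicek1995, Thm. 12.4.3 (|ρ| ≤ n − n^{ε^{d−1}})] -/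
theorem levelSize_poly (d : ℕ) : ∃ A B : ℕ, 1 ≤ A ∧ 1 ≤ B ∧ ∀ s, levelSize s (baseOf s) d ≤ A * (s + 1) ^ B := by
  induction d with
  | zero =>
    refine ⟨40, 1, by omega, le_rfl, fun s => ?_⟩
    rw [levelSize, baseOf, pow_one]
    omega
  | succ d ih =>
    obtain ⟨A, B, hA, hB, h⟩ := ih
    refine ⟨5 * (A + 2) ^ 6, 6 * B, Nat.mul_pos (by norm_num) (Nat.pow_pos (by omega)), by omega, fun s => ?_⟩
    have hstep := levelSize_succ_le s (baseOf s) d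
    have hT : levelSize s (baseOf s) d + 2 * s + 2 ≤ (A + 2) * (s + 1) ^ B := by
      have h1 := h s
      have h2 : s + 1 ≤ (s + 1) ^ B := by
        calc s + 1 = (s + 1) ^ 1 := (pow_one _).symm
          _ ≤ (s + 1) ^ B := Nat.pow_le_pow_right (Nat.succ_pos s) hB
      nlinarith
    calc levelSize s (baseOf s) (d + 1) ≤ 5 * (levelSize s (baseOf s) d + 2 * s + 2) ^ 6 := hstep
      _ ≤ 5 * ((A + 2) * (s + 1) ^ B) ^ 6 := by gcongr
      _ = 5 * (A + 2) ^ 6 * (s + 1) ^ (6 * B) := by rw [mul_pow, ← pow_mul, Nat.mul_comm B 6]; ring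

end Literature.Computability.MetaComplexity
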